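import Mathlib.RingTheory.AlgebraicIndependent.Transcendental
import Mathlib.Algebra.Polynomial.Degree.Lemmas
import Mathlib.Algebra.Polynomial.Degree.SmallDegree
import Mathlib.Data.Finsupp.Option
import HarnessLib

/-!
# Generic linear forms in algebraically independent coefficients are algebraically independent (Hodge–Pedoe X §6) — proved

Topic `Literature/RingTheory/AlgebraicIndependent`. The classical lemma behind the existence of the
Cayley (Chow) form of a projective variety (Hodge–Pedoe, *Methods of Algebraic Geometry* II, Ch. X §6,
proof of Thm. I: "`ζ₁, …, ζ_d` are algebraically independent over `K(u_{ij})`", where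
`ζ_i = −∑_j u_{ij} ξ_j` are generic linear combinations of the coordinates `ξ_j` of a generic point of
a variety of dimension `d`), in a form that needs no field theory:

* `algebraicIndependent_linFamily` — if `g : ι → A` is algebraically independent over `R`, then so is
  the family of `A[X]` consisting of `X`, of `g(j₁) · X + c` and of the constants `g(j)`, `j ≠ j₁`,
  for ANY `c ∈ A` (a leading-coefficient argument: the `X^N`-coefficient of a would-be relation, `N`
  the top weight, is a non-trivial relation among the `g(j)`);
* `algebraicIndependent_X_etaT` — consequently (induction over the blocks, swapping one constant
  `t_{b i}` for the form `η_i` at a time), for `t : κ → S` with an algebraically independent subfamily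
  `t ∘ b`, `b : {i ≠ i₀} → κ`, the variables `u_{ik}` of `S[u_{ik} : i ∈ Fin r, k ∈ κ]` together
  with the `r − 1` linear forms `η_i = ∑_k t_k u_{ik}`, `i ≠ i₀`, are algebraically independent
  over `ℚ`.

Hodge–Pedoe's own argument ("the dependence subsists under the specialisation `u_{rs} ↦ −δ_{i_r s}`")
needs care to make rigorous (the coefficients of the relation may vanish at the special point); the
leading-coefficient argument avoids specialising.

## References

* [HodgePedoe1994] W. V. D. Hodge, D. Pedoe, *Methods of Algebraic Geometry* II (CUP 1952, repr.
  1994), Ch. X §6, proof of Thm. I; Ch. X §5, Thm. VI.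
-/

noncomputable section

open MvPolynomial

namespace Literature.RingTheory.AlgebraicIndependent

section GenericLinear

variable {R : Type*} {A : Type*} [CommRing R] [CommRing A] [Algebra R A]
variable {ι : Type*} [DecidableEq ι]

/-- The family `X, C(g j₁)·X + C c, C (g j) (j ≠ j₁)` in `A[X]` attached to a family `g` in `A`,
an index `j₁` and an element `c ∈ A`. [folklore] -/
def linFamily (g : ι → A) (j₁ : ι) (c : A) : Option ι → Polynomial A := fun o =>
  o.elim Polynomial.X fun j =>
    if j = j₁ then Polynomial.C (g j₁) * Polynomial.X + Polynomial.C c else Polynomial.C (g j)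

/-- `linFamily` at `none`. [folklore] -/
@[simp] theorem linFamily_none (g : ι → A) (j₁ : ι) (c : A) : linFamily g j₁ c none = Polynomial.X := rfl

/-- `linFamily` at `j₁`. [folklore] -/
theorem linFamily_self (g : ι → A) (j₁ : ι) (c : A) :
    linFamily g j₁ c (some j₁) = Polynomial.C (g j₁) * Polynomial.X + Polynomial.C c := by
  simp [linFamily]

/-- `linFamily` at `j ≠ j₁`. [folklore] -/
theorem linFamily_of_ne (g : ι → A) {j₁ j : ι} (h : j ≠ j₁) (c : A) :
    linFamily g j₁ c (some j) = Polynomial.C (g j) := by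
  simp [linFamily, h]

/-- The "weight" `μ(X) + μ(j₁)` of an exponent vector: the `X`-degree of the corresponding monomial
in the `linFamily`. [folklore] -/
def linWt (j₁ : ι) (μ : Option ι →₀ ℕ) : ℕ := μ none + μ (some j₁)

/-- `natDegree (C t X + C c)^e ≤ e`. [folklore] -/
theorem natDegree_linear_pow_le (t c : A) (e : ℕ) :
    ((Polynomial.C t * Polynomial.X + Polynomial.C c) ^ e).natDegree ≤ e := by
  simpa using Polynomial.natDegree_pow_le_of_le e (Polynomial.natDegree_linear_le (a := t) (b := c))

/-- `coeff e (C t X + C c)^e = t^e`. [folklore] -/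
theorem coeff_linear_pow_self (t c : A) (e : ℕ) :
    ((Polynomial.C t * Polynomial.X + Polynomial.C c) ^ e).coeff e = t ^ e := by
  have h := Polynomial.coeff_pow_of_natDegree_le (m := e)
    (Polynomial.natDegree_linear_le (a := t) (b := c))
  rw [mul_one] at h
  rw [h]
  simp

/-- The value of `aeval (linFamily g j₁ c)` on a monomial, as `C b * X^a * (C t X + C c)^e`. [folklore] -/
theorem aeval_linFamily_monomial (g : ι → A) (j₁ : ι) (c : A) (μ : Option ι →₀ ℕ) (a : R) :
    aeval (linFamily g j₁ c) (monomial μ a) =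
      Polynomial.C (algebraMap R A a * (μ.some.erase j₁).prod fun j n => g j ^ n) *
        Polynomial.X ^ μ none *
          (Polynomial.C (g j₁) * Polynomial.X + Polynomial.C c) ^ μ (some j₁) := by
  rw [aeval_monomial, Finsupp.prod_option_index _ _ (by simp) (by simp [pow_add])]
  simp only [linFamily_none]
  -- split off `j₁` from the product over `μ.some`
  have hsplit : (μ.some.prod fun j n => linFamily g j₁ c (some j) ^ n) =
      (Polynomial.C (g j₁) * Polynomial.X + Polynomial.C c) ^ μ (some j₁) *
        (μ.some.erase j₁).prod fun j n => Polynomial.C (g j) ^ n := by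
    rw [← Finsupp.mul_prod_erase' μ.some j₁ _ (fun _ => pow_zero _), linFamily_self, Finsupp.some_apply]
    congr 1
    refine Finset.prod_congr rfl fun j hj' => ?_
    rw [Finsupp.support_erase] at hj'
    simp only [linFamily_of_ne g (Finset.ne_of_mem_erase hj')]
  rw [hsplit]
  have hC : ((μ.some.erase j₁).prod fun j n => Polynomial.C (g j) ^ n) =
      Polynomial.C ((μ.some.erase j₁).prod fun j n => g j ^ n) := by
    rw [Finsupp.prod, Finsupp.prod, map_prod]
    simp only [map_pow]
  rw [hC, Polynomial.algebraMap_apply, map_mul]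
  ring

/-- The `X^N`-coefficient of `aeval (linFamily) (monomial μ a)` for `N ≥ wt μ`. [folklore] -/
theorem coeff_aeval_linFamily_monomial (g : ι → A) (j₁ : ι) (c : A) (μ : Option ι →₀ ℕ) (a : R)
    {N : ℕ} (hN : linWt j₁ μ ≤ N) :
    (aeval (linFamily g j₁ c) (monomial μ a)).coeff N =
      if linWt j₁ μ = N then algebraMap R A a * μ.some.prod (fun j n => g j ^ n) else 0 := by
  classical
  rw [aeval_linFamily_monomial, mul_assoc, Polynomial.coeff_C_mul, Polynomial.coeff_X_pow_mul']
  rw [linWt] at hN ⊢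
  rw [if_pos (by omega)]
  by_cases h : μ none + μ (some j₁) = N
  · rw [if_pos h]
    have hNsub : N - μ none = μ (some j₁) := by omega
    rw [hNsub, coeff_linear_pow_self, mul_assoc]
    congr 1
    -- reassemble the product over `μ.some`
    rw [← Finsupp.mul_prod_erase' μ.some j₁ (fun j n => g j ^ n) (fun _ => pow_zero _), Finsupp.some_apply,
      mul_comm]
  · rw [if_neg h]
    have hlt : ((Polynomial.C (g j₁) * Polynomial.X + Polynomial.C c) ^ μ (some j₁)).natDegree <
        N - μ none := lt_of_le_of_lt (natDegree_linear_pow_le _ _ _) (by omega)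
    rw [Polynomial.coeff_eq_zero_of_natDegree_lt hlt, mul_zero]

/-- **Generic linear substitution preserves algebraic independence**: if `g : ι → A` is
algebraically independent over `R`, then so is the family of `A[X]` consisting of
`X`, of `g(j₁) X + c` and of the constants `g(j)`, `j ≠ j₁` — whatever `c ∈ A` is. (The step of
the classical lemma that generic linear combinations of the coordinates of a variety are
algebraically independent, Hodge–Pedoe II, Ch. X §6, proof of Thm. I.) [folklore] -/
theorem algebraicIndependent_linFamily {g : ι → A} (hg : AlgebraicIndependent R g) (j₁ : ι) (c : A) :
    AlgebraicIndependent R (linFamily g j₁ c) := by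
  classical
  rw [algebraicIndependent_iff]
  intro P hP
  by_contra hP0
  -- the top weight
  obtain ⟨μ₀, hμ₀, hmax⟩ := P.support.exists_max_image (linWt j₁) (MvPolynomial.support_nonempty.2 hP0)
  set N := linWt j₁ μ₀ with hNdef
  -- the coefficient of `X^N`
  have hcoeff : (aeval (linFamily g j₁ c) P).coeff N =
      aeval g (∑ μ ∈ P.support.filter (fun μ => linWt j₁ μ = N), monomial μ.some (coeff μ P)) := by
    conv_lhs => rw [P.as_sum]
    rw [map_sum, Polynomial.finsetSum_coeff, map_sum, Finset.sum_filter]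
    refine Finset.sum_congr rfl fun μ hμ => ?_
    rw [coeff_aeval_linFamily_monomial g j₁ c μ _ (hmax μ hμ)]
    split_ifs with h
    · rw [aeval_monomial]
    · rfl
  have hbar : (∑ μ ∈ P.support.filter (fun μ => linWt j₁ μ = N), monomial μ.some (coeff μ P)) ≠ 0 := by
    intro h0
    have hc := congrArg (coeff μ₀.some) h0
    rw [coeff_sum, coeff_zero] at hc
    have : ∑ μ ∈ P.support.filter (fun μ => linWt j₁ μ = N), coeff μ₀.some (monomial μ.some (coeff μ P)) =
        coeff μ₀ P := by
      rw [Finset.sum_eq_single μ₀]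
      · rw [coeff_monomial, if_pos rfl]
      · intro μ hμ hne
        rw [coeff_monomial, if_neg]
        intro heq
        apply hne
        -- `μ.some = μ₀.some` and equal weights force `μ = μ₀`
        rw [Finset.mem_filter] at hμ
        have hw := hμ.2
        rw [hNdef, linWt, linWt] at hw
        have hj : μ (some j₁) = μ₀ (some j₁) := by
          have := congrArg (fun f => f j₁) heq
          simpa [Finsupp.some_apply] using this
        ext o
        rcases o with _ | j
        · omega
        · have := congrArg (fun f => f j) heq
          simpa [Finsupp.some_apply] using this
      · intro h
        exact absurd (Finset.mem_filter.2 ⟨hμ₀, hNdef.symm⟩) h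
    rw [this] at hc
    exact (mem_support_iff.1 hμ₀) hc
  have hne : aeval g (∑ μ ∈ P.support.filter (fun μ => linWt j₁ μ = N), monomial μ.some (coeff μ P)) ≠ 0 :=
    fun h => hbar ((algebraicIndependent_iff.1 hg) _ h)
  apply hne
  rw [← hcoeff, hP, Polynomial.coeff_zero]

end GenericLinear

/-! ### Generic linear forms: `{u_{ik}} ∪ {∑_k t_k u_{ik}}_{i ≠ i₀}` is algebraically independent -/

section GenericForms

variable {S : Type*} [CommRing S] [Algebra ℚ S]
variable {r : ℕ} {κ : Type*} [Fintype κ] [DecidableEq κ]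

/-- `η_i = ∑_k t_k u_{ik} ∈ S[u]`. [folklore] -/
def etaT (t : κ → S) (i : Fin r) : MvPolynomial (Fin r × κ) S := ∑ k : κ, C (t k) * X (i, k)

/-- The interpolating families: `u ↦ u`, and at `i ≠ i₀` either `η_i` (for `i ∈ I`) or the
constant `t_{b i}` (for `i ∉ I`). [folklore] -/
def famT (t : κ → S) (i₀ : Fin r) (b : {i : Fin r // i ≠ i₀} → κ) (I : Finset {i : Fin r // i ≠ i₀}) :
    (Fin r × κ) ⊕ {i : Fin r // i ≠ i₀} → MvPolynomial (Fin r × κ) S :=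
  Sum.elim (fun s => X s) fun i => if i ∈ I then etaT t i.val else C (t (b i))

omit [DecidableEq κ] in
/-- Base case: `{u_{ik}} ∪ {t_{b i}}` is algebraically independent over `ℚ`. [folklore] -/
theorem algebraicIndependent_famT_empty {t : κ → S} {i₀ : Fin r} {b : {i : Fin r // i ≠ i₀} → κ}
    (hb : AlgebraicIndependent ℚ (t ∘ b)) : AlgebraicIndependent ℚ (famT t i₀ b ∅) := by
  have e : famT t i₀ b ∅ =
      Sum.elim (fun s => X s) (algebraMap S (MvPolynomial (Fin r × κ) S) ∘ (t ∘ b)) := by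
    funext o
    rcases o with s | i
    · rfl
    · simp [famT]
  rw [e]
  exact hb.sumElim_comp (MvPolynomial.algebraicIndependent_X (Fin r × κ) S)

section Step

variable (t : κ → S) {i₀ : Fin r} (b : {i : Fin r // i ≠ i₀} → κ)
  (I : Finset {i : Fin r // i ≠ i₀}) (i₁ : {i : Fin r // i ≠ i₀})

/-- The variables other than the distinguished `u_{i₁, b i₁}` of the inductive step. [folklore] -/
abbrev σ'T : Type _ := {s : Fin r × κ // s ≠ (i₁.val, b i₁)}

variable (S) in
/-- `A = S[u ∖ u_{i₁, b i₁}]`. [folklore] -/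
abbrev AT : Type _ := MvPolynomial (σ'T b i₁) S

omit [Fintype κ] [DecidableEq κ] in
variable {b i₁} in
/-- Index bookkeeping. [folklore] -/
theorem ne_s₀T_of_ne {i : Fin r} (hi : i ≠ i₁.val) (k : κ) : (i, k) ≠ (i₁.val, b i₁) := by
  intro h
  exact hi (congrArg Prod.fst h)

omit [Fintype κ] [DecidableEq κ] in
variable {b i₁} in
/-- Index bookkeeping. [folklore] -/
theorem ne_s₀T_of_ne_snd {k : κ} (hk : k ≠ b i₁) : (i₁.val, k) ≠ (i₁.val, b i₁) := by
  intro h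
  exact hk (congrArg Prod.snd h)

/-- `η_i` written in `A` (for `i ≠ i₁`; junk `0` at `i₁`). [folklore] -/
def etaA (i : {i : Fin r // i ≠ i₀}) : AT S b i₁ :=
  if hi : i.val = i₁.val then 0
  else ∑ k : κ, C (t k) * X ⟨(i.val, k), ne_s₀T_of_ne hi k⟩

/-- `c = ∑_{k ≠ b i₁} t_k u_{i₁ k} ∈ A`. [folklore] -/
def cA : AT S b i₁ :=
  ∑ k ∈ (Finset.univ.erase (b i₁)).attach,
    C (t k) * X ⟨(i₁.val, k.val), ne_s₀T_of_ne_snd (Finset.ne_of_mem_erase k.2)⟩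

/-- The family `g` in `A`. [folklore] -/
def gA : σ'T b i₁ ⊕ {i : Fin r // i ≠ i₀} → AT S b i₁ :=
  Sum.elim (fun s => X s) fun i => if i ∈ I then etaA t b i₁ i else C (t (b i))

variable (S) in
/-- `A → S[u]`, re-embedding the variables. [folklore] -/
def ψT : AT S b i₁ →ₐ[ℚ] MvPolynomial (Fin r × κ) S :=
  (rename (Subtype.val : σ'T b i₁ → Fin r × κ)).restrictScalars ℚ

omit [Fintype κ] [DecidableEq κ] in
/-- `ψ` is injective. [folklore] -/
theorem ψT_injective : Function.Injective (ψT S b i₁) :=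
  rename_injective _ Subtype.val_injective

omit [Fintype κ] [DecidableEq κ] in
/-- `ψ` on variables. [folklore] -/
@[simp] theorem ψT_X (s : σ'T b i₁) : ψT S b i₁ (X s) = X s.val := by
  simp [ψT]

omit [Fintype κ] [DecidableEq κ] in
/-- `ψ` on constants. [folklore] -/
@[simp] theorem ψT_C (a : S) : ψT S b i₁ (C a) = C a := by
  simp [ψT]

variable {b i₁} in
omit [DecidableEq κ] in
/-- `ψ(η_i^A) = η_i`. [folklore] -/
theorem ψT_etaA {i : {i : Fin r // i ≠ i₀}} (hi : i.val ≠ i₁.val) :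
    ψT S b i₁ (etaA t b i₁ i) = etaT t i.val := by
  rw [etaA, dif_neg hi, etaT, map_sum]
  refine Finset.sum_congr rfl fun k _ => ?_
  rw [map_mul, ψT_C, ψT_X]

/-- `ψ(c) = ∑_{k ≠ b i₁} t_k u_{i₁ k}`. [folklore] -/
theorem ψT_cA : ψT S b i₁ (cA t b i₁) = ∑ k ∈ Finset.univ.erase (b i₁), C (t k) * X (i₁.val, k) := by
  rw [cA, map_sum, ← Finset.sum_attach (Finset.univ.erase (b i₁))]
  refine Finset.sum_congr rfl fun k _ => ?_
  rw [map_mul, ψT_C, ψT_X]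

omit [DecidableEq κ] in
variable {I i₁} in
/-- `ψ ∘ g = famT I ∘ (index embedding)` when `i₁ ∉ I`. [folklore] -/
theorem ψT_comp_gA (hi₁ : i₁ ∉ I) :
    (ψT S b i₁) ∘ gA t b I i₁ = famT t i₀ b I ∘ Sum.map Subtype.val id := by
  funext o
  rcases o with s | i
  · simp [gA, famT]
  · simp only [Function.comp_apply, gA, famT, Sum.map_inr, id_eq, Sum.elim_inr]
    by_cases hi : i ∈ I
    · have hne : i.val ≠ i₁.val := fun h => hi₁ (by rwa [Subtype.ext h] at hi)
      rw [if_pos hi, if_pos hi, ψT_etaA t hne]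
    · rw [if_neg hi, if_neg hi, ψT_C]

omit [DecidableEq κ] in
variable {I i₁} in
/-- `g` is algebraically independent if `famT I` is. [folklore] -/
theorem algebraicIndependent_gA (hI : AlgebraicIndependent ℚ (famT t i₀ b I)) (hi₁ : i₁ ∉ I) :
    AlgebraicIndependent ℚ (gA t b I i₁) := by
  have h : AlgebraicIndependent ℚ (famT t i₀ b I ∘ Sum.map (Subtype.val : σ'T b i₁ → _) id) :=
    hI.comp _ (Sum.map_injective.2 ⟨Subtype.val_injective, Function.injective_id⟩)
  rw [← ψT_comp_gA t b hi₁] at h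
  exact AlgebraicIndependent.of_comp (ψT S b i₁) h

variable (S) in
/-- `χ : A[X] → S[u]`, `X ↦ u_{i₁, b i₁}`, `C q ↦ ψ q` (a composition of algebra isomorphisms, hence
injective). [folklore] -/
def χT : Polynomial (AT S b i₁) →ₐ[ℚ] MvPolynomial (Fin r × κ) S :=
  (((renameEquiv S (Equiv.optionSubtypeNe (i₁.val, b i₁))).toAlgHom.comp
    (optionEquivLeft S (σ'T b i₁)).symm.toAlgHom).restrictScalars ℚ)

omit [Fintype κ] in
/-- `χ` is injective. [folklore] -/
theorem χT_injective : Function.Injective (χT S b i₁) := by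
  change Function.Injective (((renameEquiv S (Equiv.optionSubtypeNe (i₁.val, b i₁))).toAlgHom.comp
    (optionEquivLeft S (σ'T b i₁)).symm.toAlgHom))
  exact (renameEquiv S _).injective.comp (optionEquivLeft S _).symm.injective

omit [Fintype κ] in
/-- `χ(X) = u_{i₁, b i₁}`. [folklore] -/
@[simp] theorem χT_X : χT S b i₁ Polynomial.X = X (i₁.val, b i₁) := by
  simp [χT]

omit [Fintype κ] in
/-- `χ(C q) = ψ(q)`. [folklore] -/
@[simp] theorem χT_C (q : AT S b i₁) : χT S b i₁ (Polynomial.C q) = ψT S b i₁ q := by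
  change (renameEquiv S (Equiv.optionSubtypeNe (i₁.val, b i₁)))
    ((optionEquivLeft S (σ'T b i₁)).symm (Polynomial.C q)) = rename Subtype.val q
  rw [optionEquivLeft_symm_apply, Polynomial.aevalTower_C, renameEquiv_apply, rename_rename]
  rfl

/-- The index bijection `Option (σ' ⊕ I₁) → (Fin r × κ) ⊕ I₁`. [folklore] -/
def idxT : Option (σ'T b i₁ ⊕ {i : Fin r // i ≠ i₀}) → (Fin r × κ) ⊕ {i : Fin r // i ≠ i₀} := fun o =>
  o.elim (Sum.inl (i₁.val, b i₁)) (Sum.map Subtype.val id)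

omit [Fintype κ] in
/-- `idxT` is a bijection. [folklore] -/
theorem idxT_bijective : Function.Bijective (idxT (r := r) b i₁) := by
  constructor
  · rintro (_ | ⟨s | i⟩) (_ | ⟨s' | i'⟩) h
    · rfl
    · simp only [idxT, Option.elim_none, Option.elim_some, Sum.map_inl, Sum.inl.injEq] at h
      exact absurd h.symm s'.2
    · simp [idxT] at h
    · simp only [idxT, Option.elim_none, Option.elim_some, Sum.map_inl, Sum.inl.injEq] at h
      exact absurd h s.2
    · simp only [idxT, Option.elim_some, Sum.map_inl, Sum.inl.injEq] at h
      rw [Subtype.ext h]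
    · simp [idxT] at h
    · simp [idxT] at h
    · simp [idxT] at h
    · simp only [idxT, Option.elim_some, Sum.map_inr, id_eq, Sum.inr.injEq] at h
      rw [h]
  · rintro (s | i)
    · by_cases hs : s = (i₁.val, b i₁)
      · exact ⟨none, by simp [idxT, hs]⟩
      · exact ⟨some (Sum.inl ⟨s, hs⟩), rfl⟩
    · exact ⟨some (Sum.inr i), rfl⟩

variable {I i₁} in
/-- `χ ∘ linFamily = famT (insert i₁ I) ∘ idx`. [folklore] -/
theorem χT_comp_linFamily (hi₁ : i₁ ∉ I) :
    (χT S b i₁) ∘ linFamily (gA t b I i₁) (Sum.inr i₁) (cA t b i₁) =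
      famT t i₀ b (insert i₁ I) ∘ idxT b i₁ := by
  classical
  funext o
  rcases o with _ | ⟨s | i⟩
  · simp [idxT, famT]
  · rw [Function.comp_apply, linFamily_of_ne _ (by simp), χT_C]
    simp [gA, idxT, famT]
  · by_cases hi : i = i₁
    · subst hi
      rw [Function.comp_apply, linFamily_self, map_add, map_mul, χT_C, χT_X, χT_C, ψT_cA]
      simp only [gA, Sum.elim_inr, if_neg hi₁, ψT_C, Function.comp_apply, idxT, Option.elim_some,
        Sum.map_inr, id_eq, famT, Finset.mem_insert_self, if_true, etaT]
      rw [← Finset.add_sum_erase _ _ (Finset.mem_univ (b i))]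
    · rw [Function.comp_apply, linFamily_of_ne _ (by simpa using hi), χT_C]
      simp only [gA, Sum.elim_inr, Function.comp_apply, idxT, Option.elim_some, Sum.map_inr, id_eq,
        famT, Finset.mem_insert, hi, false_or]
      by_cases hiI : i ∈ I
      · have hne : i.val ≠ i₁.val := fun h => hi (Subtype.ext h)
        rw [if_pos hiI, if_pos hiI, ψT_etaA t hne]
      · rw [if_neg hiI, if_neg hiI, ψT_C]

variable {I i₁} in
/-- The inductive step. [folklore] -/
theorem algebraicIndependent_famT_insert (hI : AlgebraicIndependent ℚ (famT t i₀ b I)) (hi₁ : i₁ ∉ I) :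
    AlgebraicIndependent ℚ (famT t i₀ b (insert i₁ I)) := by
  classical
  have hg := algebraicIndependent_gA t b hI hi₁
  have hlin := algebraicIndependent_linFamily hg (Sum.inr i₁) (cA t b i₁)
  have hχ : AlgebraicIndependent ℚ
      ((χT S b i₁) ∘ linFamily (gA t b I i₁) (Sum.inr i₁) (cA t b i₁)) :=
    hlin.map' (χT_injective b i₁)
  rw [χT_comp_linFamily t b hi₁] at hχ
  exact (algebraicIndependent_equiv (Equiv.ofBijective _ (idxT_bijective b i₁))).1 hχ

end Step

/-- **Generic linear forms are algebraically independent**: if `t : κ → S` has an algebraically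
independent subfamily `t ∘ b` indexed by `{i ≠ i₀}`, then in `S[u_{ik}]` the variables `u_{ik}`
together with the `r − 1` linear forms `η_i = ∑_k t_k u_{ik}`, `i ≠ i₀`, are algebraically
independent over `ℚ` (Hodge–Pedoe II, Ch. X §6, proof of Thm. I: "`ζ₁, …, ζ_d` are algebraically
independent over `K(u_{ij})`"). [cite: HodgePedoe1994, vol. II, Ch. X §6, Thm. I (proof)] -/
theorem algebraicIndependent_famT (t : κ → S) {i₀ : Fin r} (b : {i : Fin r // i ≠ i₀} → κ)
    (hb : AlgebraicIndependent ℚ (t ∘ b)) (I : Finset {i : Fin r // i ≠ i₀}) :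
    AlgebraicIndependent ℚ (famT t i₀ b I) := by
  classical
  induction I using Finset.induction_on with
  | empty => exact algebraicIndependent_famT_empty hb
  | insert i₁ I hi₁ ih => exact algebraicIndependent_famT_insert t b ih hi₁

/-- The case `I = univ`: `{u_{ik}} ∪ {η_i}_{i ≠ i₀}` is algebraically independent over `ℚ`.
[cite: HodgePedoe1994, vol. II, Ch. X §6, Thm. I (proof)] -/
theorem algebraicIndependent_X_etaT (t : κ → S) {i₀ : Fin r} (b : {i : Fin r // i ≠ i₀} → κ)
    (hb : AlgebraicIndependent ℚ (t ∘ b)) :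
    AlgebraicIndependent ℚ
      (Sum.elim (fun s : Fin r × κ => (X s : MvPolynomial (Fin r × κ) S))
        (fun i : {i : Fin r // i ≠ i₀} => etaT t i.val)) := by
  classical
  have h := algebraicIndependent_famT t b hb Finset.univ
  have e : famT t i₀ b Finset.univ =
      Sum.elim (fun s : Fin r × κ => (X s : MvPolynomial (Fin r × κ) S)) (fun i => etaT t i.val) := by
    funext o
    rcases o with s | i <;> simp [famT]
  rwa [e] at h

end GenericForms

end Literature.RingTheory.AlgebraicIndependent

end
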